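import Summits.BirchSwinnertonDyer.Rank1Residual.GaloisImage.UnipotentShapeConjugacy
import HarnessLib

/-!
# The `τ`-shape from KERNEL data (bridge B1, algebra half, file 2)
# (cell `b2b-bsdres`, team n1011, ROUTE-1 item R1-23, bridge (B1); seat p18; file B1-alg2)

HONEST FRAMING (verbatim for the cell): research route on the CONSTRUCTION-SHAPED class `X4` /
N11; prove what is provable now; nothing booked; no mark / label moved.  TOOL theorems of finite
group theory only — no curve, no definition, no named fact.

`UnipotentShapeConjugacy.sq_eq_zero_and_exists_addOrderOf_eq` derives the shape `(u − 1)² = 0`,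
`∃ w, ord((u − 1)w) = p^K` from COKERNEL data ((H.2) `V/(u − 1)V ≅ ℤ/p^K`, the currency of
Sakamoto's `τ`).  For a FROBENIUS `σ` at a Kolyvagin prime the natural data are KERNEL data:
`#V^{σ} = p^K` (the `3^K`-torsion of `Ẽ(𝔽_ℓ)`, read through the reduction map) and `σ` moves some
point of `V[p] = p^{K−1}V` (the cyclicity flag `#Ẽ(𝔽_ℓ)[3] ≤ 3`).  This file isolates the common
core (`sq_eq_zero_of_generator`: `#I = #V₀ = p^K`, an element of `I` not killed by `p^{K−1}`, and
an invariant non-degenerate alternating pairing give `V₀ = I`) and the kernel-currency wrapper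
`sq_eq_zero_and_exists_addOrderOf_eq_of_ker`, plus the resulting (H.2)-isomorphism
`nonempty_coker_addEquiv_zmod_of_ker` (so that a Frobenius of Kim's `𝒫_K` with the cyclicity flag
HAS Sakamoto's shape (H.2) and can serve as `τ`).

References: R. Sakamoto, Math. Ann. (2024) §2 (H.2) [Sakamoto2024]; C.-H. Kim, AJM 148 (2026)
§1.2.2 [Kim2022StructureSelmer]; B. Mazur, K. Rubin, Mem. AMS 799 (2004) §3.5 [MazurRubin2004].
-/

namespace Summit.BirchSwinnertonDyer.Rank1Residual.GaloisImage.Unipotent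

variable {V : Type*} [AddCommGroup V]

/-- **Core of the `τ`-shape argument.**  `V ≅ (ℤ/p^K)²`, `u ∈ Aut(V)`, `M = u − 1` with
`#M(V) = #ker M = p^K`, an element `x ∈ M(V)` with `p^{K−1} x ≠ 0`, and an invariant non-degenerate
alternating pairing into the `p^K`-th roots of unity of a field: then `M² = 0` and `M` takes a
value of order `p^K`. [cite: Sakamoto2024, §2 (H.2) (p. 921)] -/
theorem sq_eq_zero_of_generator {p K : ℕ} [hp : Fact p.Prime] (hK : 0 < K) [Finite V]
    (F : ZMod (p ^ K) × ZMod (p ^ K) ≃+ V) (u : V ≃+ V)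
    (hcardI : Nat.card (u.toAddMonoidHom - AddMonoidHom.id V).range = p ^ K)
    (hcardK : Nat.card (u.toAddMonoidHom - AddMonoidHom.id V).ker = p ^ K)
    {x : V} (hxI : x ∈ (u.toAddMonoidHom - AddMonoidHom.id V).range) (hx : p ^ (K - 1) • x ≠ 0)
    {L : Type*} [Field L] (e : V → V → L) (hpow : ∀ S T, e S T ^ (p ^ K) = 1)
    (haddl : ∀ S₁ S₂ T, e (S₁ + S₂) T = e S₁ T * e S₂ T)
    (haddr : ∀ S T₁ T₂, e S (T₁ + T₂) = e S T₁ * e S T₂)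
    (halt : ∀ T, e T T = 1) (hnd : ∀ T, (∀ S, e S T = 1) → T = 0)
    (hinv : ∀ S T, e (u S) (u T) = e S T) :
    (∀ v, (u.toAddMonoidHom - AddMonoidHom.id V) ((u.toAddMonoidHom - AddMonoidHom.id V) v) = 0) ∧
      ∃ w, addOrderOf ((u.toAddMonoidHom - AddMonoidHom.id V) w) = p ^ K := by
  classical
  set M := u.toAddMonoidHom - AddMonoidHom.id V with hMdef
  have hMv : ∀ v, M v = u v - v := fun v => rfl
  haveI : NeZero (p ^ K) := ⟨pow_ne_zero _ hp.out.ne_zero⟩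
  obtain ⟨hNv, hcardV⟩ := nsmul_eq_zero_and_card_of_frame F
  have hox : addOrderOf x = p ^ K := by
    obtain ⟨j, hj, hjx⟩ := (Nat.dvd_prime_pow hp.out).1 (addOrderOf_dvd_of_nsmul_eq_zero (hNv x))
    rw [hjx]
    rcases Nat.lt_or_ge j K with hlt | hge
    · exfalso
      apply hx
      have hdvd : addOrderOf x ∣ p ^ (K - 1) := by
        rw [hjx]; exact pow_dvd_pow p (by omega)
      exact addOrderOf_dvd_iff_nsmul_eq_zero.mp hdvd
    · rw [le_antisymm hj hge]
  haveI : Finite M.range :=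
    Nat.finite_of_card_ne_zero (by rw [hcardI]; exact pow_ne_zero _ hp.out.ne_zero)
  have hIx : M.range = AddSubgroup.zmultiples x := by
    symm
    exact AddSubgroup.eq_of_le_of_card_ge (AddSubgroup.zmultiples_le_of_mem hxI)
      (by rw [Nat.card_zmultiples, hox, hcardI])
  obtain ⟨w, hw⟩ : ∃ w, M w = x := hxI
  -- values of `e` are non-zero
  have hne : ∀ S T, e S T ≠ 0 := fun S T h0 => by
    have := hpow S T
    rw [h0, zero_pow (pow_ne_zero _ hp.out.ne_zero)] at this
    exact zero_ne_one this
  -- invariance: `e(S, M T) = 1` for `S ∈ ker M`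
  have horth : ∀ S, M S = 0 → ∀ T, e S (M T) = 1 := by
    intro S hS T
    have huS : u S = S := by
      have := hMv S; rw [hS] at this; exact (sub_eq_zero.mp this.symm)
    have h1 : e S (u T) = e S (M T) * e S T := by
      have hT : M T + T = u T := by rw [hMv]; abel
      rw [← hT, haddr]
    have h2 : e S (u T) = e S T := by rw [← hinv S T, huS]
    rw [h2] at h1
    exact (mul_eq_right₀ (hne S T)).mp h1.symm
  -- the character `S ↦ e(S, x)` as a hom into `Lˣ`; its kernel `X`
  let χ : V →+ Additive Lˣ := AddMonoidHom.mk' (fun S => Additive.ofMul (Units.mk0 (e S x) (hne S x)))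
    (fun S₁ S₂ => by
      apply Additive.toMul.injective
      apply Units.ext
      simp [haddl])
  have hχ : ∀ S, χ S = 0 ↔ e S x = 1 := fun S => by
    constructor
    · intro h
      have := congrArg (fun t => ((Additive.toMul t : Lˣ) : L)) h
      simpa [χ] using this
    · intro h
      apply Additive.toMul.injective
      apply Units.ext
      simpa [χ] using h
  -- multiples in either argument
  have hzero_right : ∀ S, e S 0 = 1 := fun S => by
    have h := haddr S 0 0
    rw [add_zero] at h
    exact (mul_eq_left₀ (hne S 0)).mp h.symm
  have hnsmul_right : ∀ (a : ℕ) S T, e S (a • T) = e S T ^ a := fun a S T => by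
    induction a with
    | zero => rw [zero_nsmul, pow_zero, hzero_right]
    | succ a ih => rw [succ_nsmul, haddr, ih, pow_succ]
  have hzero_left : ∀ T, e 0 T = 1 := fun T => by
    have h := haddl 0 0 T
    rw [add_zero] at h
    exact (mul_eq_left₀ (hne 0 T)).mp h.symm
  have hnsmul_left : ∀ (a : ℕ) S T, e (a • S) T = e S T ^ a := fun a S T => by
    induction a with
    | zero => rw [zero_nsmul, pow_zero, hzero_left]
    | succ a ih => rw [succ_nsmul, haddl, ih, pow_succ]
  -- the image of `χ` has at least `p^K` elements: it is a `p`-group not killed by `p^{K-1}`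
  haveI : Finite χ.range := Finite.of_surjective χ.rangeRestrict χ.rangeRestrict_surjective
  have hrange : p ^ K ≤ Nat.card χ.range := by
    have hkill : ∀ t : χ.range, p ^ K • t = 0 := fun t => by
      obtain ⟨t, S, rfl⟩ := t
      apply Subtype.ext
      change p ^ K • χ S = 0
      rw [← map_nsmul, hNv, map_zero]
    obtain ⟨j, hj⟩ := Transport.exists_natCard_eq_pow_of_nsmul_eq_zero (p := p) hkill
    rw [hj]
    rcases Nat.lt_or_ge j K with hlt | hge
    · exfalso
      apply hx
      refine hnd _ fun S => ?_
      -- `p^{K-1}` kills the image of `χ`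
      have ht : p ^ (K - 1) • (⟨χ S, S, rfl⟩ : χ.range) = 0 := by
        have h0 : p ^ j • (⟨χ S, S, rfl⟩ : χ.range) = 0 := by rw [← hj]; exact card_nsmul_eq_zero'
        obtain ⟨c, hc⟩ : p ^ j ∣ p ^ (K - 1) := pow_dvd_pow p (by omega)
        have hcc : (p ^ j * c) • (⟨χ S, S, rfl⟩ : χ.range) = c • (p ^ j • (⟨χ S, S, rfl⟩ : χ.range)) := by
          rw [← mul_nsmul, mul_comm]
        rw [hc, hcc, h0, smul_zero]
      have ht' : χ (p ^ (K - 1) • S) = 0 := by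
        rw [map_nsmul]
        exact congrArg Subtype.val ht
      rw [hχ, hnsmul_left] at ht'
      rw [hnsmul_right]
      exact ht'
    · exact Nat.pow_le_pow_right hp.out.pos hge
  -- so `#ker χ ≤ p^K`
  have hker : Nat.card χ.ker ≤ p ^ K := by
    have h := χ.ker.card_eq_card_quotient_mul_card_addSubgroup
    rw [Nat.card_congr (QuotientAddGroup.quotientKerEquivRange χ).toEquiv, hcardV, pow_two] at h
    by_contra hlt
    have : p ^ K * p ^ K < Nat.card χ.range * Nat.card χ.ker :=
      Nat.mul_lt_mul_of_le_of_lt hrange (not_le.mp hlt) (lt_of_lt_of_le (pow_pos hp.out.pos K) hrange)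
    omega
  -- `I ≤ ker χ` (alternating) and `V₀ ≤ ker χ` (invariance)
  have hIle : M.range ≤ χ.ker := by
    rw [hIx]
    intro S hS
    obtain ⟨k, rfl⟩ := AddSubgroup.mem_zmultiples_iff.mp hS
    rw [AddMonoidHom.mem_ker, map_zsmul]
    have hx0 : χ x = 0 := (hχ x).2 (halt x)
    rw [hx0, smul_zero]
  have hKle : M.ker ≤ χ.ker := fun S hS => by
    rw [AddMonoidHom.mem_ker, hχ, ← hw]
    exact horth S hS w
  haveI : Finite χ.ker := inferInstance
  have hIeq : M.range = χ.ker := AddSubgroup.eq_of_le_of_card_ge hIle (by rw [hcardI]; exact hker)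
  haveI : Finite M.ker := inferInstance
  have hKeq : M.ker = M.range :=
    AddSubgroup.eq_of_le_of_card_ge (hIeq ▸ hKle) (by rw [hcardI, hcardK])
  refine ⟨fun v => ?_, w, by rw [hw, hox]⟩
  have hv : M v ∈ M.ker := by rw [hKeq]; exact ⟨v, rfl⟩
  exact hv


/-- **The `τ`-shape from kernel data**: `V ≅ (ℤ/p^K)²`, `u ∈ Aut(V)` with `#V^{u} = p^K`
(`V^u = ker (u − 1)`), some `v` with `p^{K−1}(u v − v) ≠ 0` (i.e. `u` moves a point of
`V[p] = p^{K−1}V`), and an invariant non-degenerate alternating pairing into the `p^K`-th roots of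
unity of a field: then `(u − 1)² = 0` and `u − 1` takes a value of order `p^K`.  (The currency of a
Frobenius at a Kolyvagin prime of Kim's `𝒫_K` with the cyclicity flag.)
[cite: Kim2022StructureSelmer, §1.2.2] [cite: Sakamoto2024, §2 (H.2) (p. 921)] -/
theorem sq_eq_zero_and_exists_addOrderOf_eq_of_ker {p K : ℕ} [hp : Fact p.Prime] (hK : 0 < K)
    [Finite V] (F : ZMod (p ^ K) × ZMod (p ^ K) ≃+ V) (u : V ≃+ V)
    (hker : Nat.card (u.toAddMonoidHom - AddMonoidHom.id V).ker = p ^ K)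
    (hmove : ∃ v, p ^ (K - 1) • (u v - v) ≠ 0)
    {L : Type*} [Field L] (e : V → V → L) (hpow : ∀ S T, e S T ^ (p ^ K) = 1)
    (haddl : ∀ S₁ S₂ T, e (S₁ + S₂) T = e S₁ T * e S₂ T)
    (haddr : ∀ S T₁ T₂, e S (T₁ + T₂) = e S T₁ * e S T₂)
    (halt : ∀ T, e T T = 1) (hnd : ∀ T, (∀ S, e S T = 1) → T = 0)
    (hinv : ∀ S T, e (u S) (u T) = e S T) :
    (∀ v, (u.toAddMonoidHom - AddMonoidHom.id V) ((u.toAddMonoidHom - AddMonoidHom.id V) v) = 0) ∧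
      ∃ w, addOrderOf ((u.toAddMonoidHom - AddMonoidHom.id V) w) = p ^ K := by
  set M := u.toAddMonoidHom - AddMonoidHom.id V with hMdef
  haveI : NeZero (p ^ K) := ⟨pow_ne_zero _ hp.out.ne_zero⟩
  obtain ⟨hNv, hcardV⟩ := nsmul_eq_zero_and_card_of_frame F
  -- `#I = p^K` from `#ker M = p^K` and `#V = p^{2K}`
  have hcardI : Nat.card M.range = p ^ K := by
    have h := M.ker.card_eq_card_quotient_mul_card_addSubgroup
    rw [Nat.card_congr (QuotientAddGroup.quotientKerEquivRange M).toEquiv, hker, hcardV,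
      pow_two] at h
    exact (Nat.eq_of_mul_eq_mul_right (pow_pos hp.out.pos K) h).symm
  obtain ⟨v, hv⟩ := hmove
  exact sq_eq_zero_of_generator hK F u hcardI hker ⟨v, rfl⟩ hv e hpow haddl haddr halt hnd hinv

/-- **(H.2) from kernel data**: under the hypotheses of
`sq_eq_zero_and_exists_addOrderOf_eq_of_ker`, `V/(u − 1)V ≃ ℤ/p^K` — so a Frobenius at a prime of
Kim's `𝒫_K` with the cyclicity flag has Sakamoto's shape (H.2) and may serve as his `τ`.
[cite: Sakamoto2024, §2 (H.2) (p. 921)] [cite: Kim2022StructureSelmer, §1.2.2] -/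
theorem nonempty_coker_addEquiv_zmod_of_ker {p K : ℕ} [hp : Fact p.Prime] (hK : 0 < K)
    [Finite V] (F : ZMod (p ^ K) × ZMod (p ^ K) ≃+ V) (u : V ≃+ V)
    (hker : Nat.card (u.toAddMonoidHom - AddMonoidHom.id V).ker = p ^ K)
    (hmove : ∃ v, p ^ (K - 1) • (u v - v) ≠ 0)
    {L : Type*} [Field L] (e : V → V → L) (hpow : ∀ S T, e S T ^ (p ^ K) = 1)
    (haddl : ∀ S₁ S₂ T, e (S₁ + S₂) T = e S₁ T * e S₂ T)
    (haddr : ∀ S T₁ T₂, e S (T₁ + T₂) = e S T₁ * e S T₂)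
    (halt : ∀ T, e T T = 1) (hnd : ∀ T, (∀ S, e S T = 1) → T = 0)
    (hinv : ∀ S T, e (u S) (u T) = e S T) :
    Nonempty (V ⧸ (u.toAddMonoidHom - AddMonoidHom.id V).range ≃+ ZMod (p ^ K)) := by
  classical
  set M := u.toAddMonoidHom - AddMonoidHom.id V with hMdef
  haveI : NeZero (p ^ K) := ⟨pow_ne_zero _ hp.out.ne_zero⟩
  obtain ⟨hNv, hcardV⟩ := nsmul_eq_zero_and_card_of_frame F
  obtain ⟨hsq, w, hw⟩ :=
    sq_eq_zero_and_exists_addOrderOf_eq_of_ker hK F u hker hmove e hpow haddl haddr halt hnd hinv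
  -- the frame `(Mw, w)`: `V = ⟨Mw⟩ ⊕ ⟨w⟩`, `M(V) = ⟨Mw⟩`, so `V/M(V) ≅ ⟨w⟩ ≅ ℤ/p^K`
  obtain ⟨f, hf⟩ := exists_frameHom (N := p ^ K) (M w) w (hNv _) (hNv _)
  have hbij := frame_bijective hcardV M hsq hw f hf
  let Fr : ZMod (p ^ K) × ZMod (p ^ K) ≃+ V := AddEquiv.ofBijective f hbij
  -- the map `V → ℤ/p^K`, second coordinate in the frame
  let π : V →+ ZMod (p ^ K) := (AddMonoidHom.snd _ _).comp Fr.symm.toAddMonoidHom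
  have hπ : ∀ a b : ZMod (p ^ K), π (Fr (a, b)) = b := fun a b => by
    change (Fr.symm (Fr (a, b))).2 = b
    rw [AddEquiv.symm_apply_apply]
  have hπsurj : Function.Surjective π := fun b => ⟨Fr (0, b), hπ 0 b⟩
  have hMFr : ∀ a b : ZMod (p ^ K), M (Fr (a, b)) = Fr (b, 0) := fun a b => by
    change M (f (a, b)) = f (b, 0)
    rw [hf, hf, map_add, map_nsmul, map_nsmul, hsq, smul_zero, zero_add, ZMod.val_zero, zero_smul,
      add_zero]
  have hkerπ : π.ker = M.range := by
    ext v
    obtain ⟨⟨a, b⟩, rfl⟩ := Fr.surjective v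
    rw [AddMonoidHom.mem_ker, hπ]
    constructor
    · rintro rfl
      exact ⟨Fr (0, a), hMFr 0 a⟩
    · rintro ⟨v', hv'⟩
      obtain ⟨⟨c, d⟩, rfl⟩ := Fr.surjective v'
      rw [hMFr] at hv'
      have := congrArg Prod.snd (Fr.injective hv')
      exact this.symm
  exact ⟨(QuotientAddGroup.quotientAddEquivOfEq hkerπ.symm).trans
    (QuotientAddGroup.quotientKerEquivOfSurjective π hπsurj)⟩

end Summit.BirchSwinnertonDyer.Rank1Residual.GaloisImage.Unipotent
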